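import Summits.ABC.IUTFork.Cor312FrameVolumePiecesDH
import HarnessLib

/-!
# [IUTchIII] Corollary 3.12, statement — CONTAINER-ROBUSTNESS of the typed statement at the assembled real setting:
# field-box volumes (`Real.settingDHFrames`) versus the verbatim summandwise `𝕄(−)` (`Real.settingDHVol`)

PROOF-ONLY companion (D-0012 record file; abc-iut cell, Cor. 3.12 sub-crew, seat abc-iut-c312-6, gen 5; TEAM B
real-setting lane) of `Cor312FrameVolumePiecesDH`; TAKES NO SIDE; 0 `def`s, 0 `Prop` facts. There: the field-box volume
pieces `Real.frameVolumePiecesDH X hlog : Cor312Vol.FrameVolumePieces (Real.logShellsDH X logv)` (the first kernel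
term of that type), their AGREEMENT with abc-iut-c312-5's verbatim summandwise container on hull-set preimages at every
place (`logvol_frameVolumePiecesDH_preimage_hullSet` / `_of_isHullSet`), and the field-box twin `Real.settingDHFrames`
(c312-7's `Setting.ofFrames`, `hadm` discharged) of c312-5's assembled setting of record `Real.settingDHVol`
(`Cor312SettingDHVol`), over the SAME binders. Here, for every such binder list:

* by `rfl`: the two settings have the same hull frames (c312-7 `HullFrame.ofComparison = (ofLocalFields _).comap _`),
  the same possible images of the Θ-pilot object (same Θ-boxes, same comparison, same (Ind1)(Ind2)-group of the
  common log-shell signature), the same `q`-pilot region, the same hull `^{n,∘}𝒰_{j,v_ℚ}`, the same `HullDefined`;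
* by the hull-set agreement: the same `qLocal` (at `λ_q·𝒪_L`, `λ_q ≠ 0`), the same `thetaLocal` (when the union of the
  possible images admits its hull, that hull IS the preimage of a hull-set `λ·𝒪_L` of the common frame — `hull_mem_of_hasHull`;
  otherwise both read `+∞`), hence the same `ThetaFinite`, `−|log(Θ)|` and `−|log(q)|`;
* **`statement_settingDHFrames_iff`**: the printed statement "`−|log(Θ)| ∈ ℝ` and `−|log(Θ)| ≥ −|log(q)|`" ([IUTchIII]
  Cor. 3.12, kurims `paper:url-4b091feeb646` p. 174 l. 16–18), typed by c312-7 as `Cor312.Setting.Statement`, holds at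
  the field-box reading of `𝕄(−)` ([IUTchIII] Rmk. 3.1.1 (iii) p. 95 read as boxes over the FIELD FACTORS — the
  c312-6/c312-7 frames route) iff it holds at the verbatim reading (direct products over the SUMMANDS `v⃗` — the c312-5
  route). CONSEQUENCE (bookkeeping, no new content): every frames-route theorem of the cone stated over
  `variable (V : FrameVolumePieces L)` + `V.Realizes (S.D n)` (c312-6 `qLocal_ofFrames`/`hKumA_ofFrames`/
  `Cor312ThetaAdmFrames*`/`Cor312TeamBCapstoneSummands*`, abc-iut-c312-10 `Cor312NotPointwiseFrames`, c312-8
  `Cor312ProvenanceFrames`) instantiates at `V := Real.frameVolumePiecesDH X hlog` (genuine `p`-adic field factors) and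
  its conclusion about `Statement`/`ThetaFinite`/`negLogTheta`/`negLogQ` transfers verbatim to the setting of record.
[claim: Mochizuki2012, status: disputed] for the quoted statement; everything here is proved bookkeeping. Neither side
of any `↔` is asserted. Typed ≠ proved; instantiated ≠ endorsed.
-/

noncomputable section

open Set Function

namespace Summit.ABC

namespace IUTFork

namespace Thm311

namespace Real

open Cor312 Cor312Vol Literature.IUT.LogThetaLattice Literature.IUT.LogVolume

variable {F : Type} [Field F] [NumberField F] (X : PilotData F) {logv : PadicLogs F} (hlog : LogvAnalytic logv)
  (M : Type) [Field M] [NumberField M]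
  (archPk : ∀ (j : (thetaIndex X).Label) (vQ : (thetaIndex X).VQ), Set ((logShellsDH X logv).Packet j vQ))
  (archSub : ∀ (j : (thetaIndex X).Label) (v : (thetaIndex X).V),
    Set ((logShellsDH X logv).Packet j ((thetaIndex X).over v)))
  (Ψ : ℤ → ∀ v : (thetaIndex X).V, v ∈ (thetaIndex X).Vbad → Set ((logShellsDH X logv).StarPacket v))
  (act : ℤ → ∀ v : (thetaIndex X).V, v ∈ (thetaIndex X).Vbad →
    (logShellsDH X logv).StarPacket v → Module.End ℚ ((logShellsDH X logv).StarPacket v))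
  (Mmod : ℤ → ∀ j : (thetaIndex X).LabelStar, Set ((logShellsDH X logv).GlobalPacket j.1))
  (region : ℤ → ∀ j : (thetaIndex X).LabelStar, FinDivisor M → ∀ vQ : (thetaIndex X).VQ,
    Set ((logShellsDH X logv).Packet j.1 vQ))
  (n : ℤ) {HT : Type} {LogLink : HT → HT → Type} {IsFull : ∀ {s t : HT}, LogLink s t → Prop}
  (lat : LGPGaussianLogThetaLattice LogLink IsFull)
  {Frd : Type} {IsoF : Frd → Frd → Type} {Ob : Frd → Type} {realify : Frd → Frd} {Strip : Type}
  {IsoS : Strip → Strip → Type} {Mv : ∀ v : (thetaIndex X).V, v ∈ (thetaIndex X).Vbad → Type}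
  [∀ v h, Monoid (Mv v h)]
  (sig : GlobalLGPFrobenioidSignature (thetaIndex X).lstar (thetaIndex X).V (· ∈ (thetaIndex X).Vbad)
    Frd IsoF Ob realify Strip IsoS Mv)
  (split : SplittingMonoids Mv) {ObΔ : Type} {N : ∀ v : (thetaIndex X).V, v ∈ (thetaIndex X).Vbad → Type}
  [∀ v h, Monoid (N v h)] (qData : QPilotData ObΔ N)
  (thetaBox : ℤ → Ob sig.Clgp → ∀ (j : (thetaIndex X).Label) (vQ : (thetaIndex X).VQ),
    Set (∀ s : factorIdxDH X hlog j vQ, factorFieldDH X hlog j vQ s))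
  (qCentre : ObΔ → ∀ (j : (thetaIndex X).Label) (vQ : (thetaIndex X).VQ),
    ∀ s : factorIdxDH X hlog j vQ, factorFieldDH X hlog j vQ s)
  (hq : ∀ j vQ s, qCentre (qPilotObject qData) j vQ s ≠ 0)
  (hfin : ∀ j : (thetaIndex X).Label, (Function.support fun vQ =>
    ((situationDHVol X hlog M archPk archSub Ψ act Mmod region).D n).logvol j vQ
      (factorMapDH X hlog j vQ ⁻¹' hullSet (factorFieldDH X hlog j vQ) (qCentre (qPilotObject qData) j vQ))).Finite)

/-- Same hull frames: the real frame of `Π_{(v⃗,i)} L_{v⃗,i}` pulled back along the field-factor comparison (c312-7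
`HullFrame.ofComparison = (ofLocalFields _).comap _`). [folklore] -/
theorem frame_settingDHFrames (j : (thetaIndex X).Label) (vQ : (thetaIndex X).VQ) :
    (settingDHFrames X hlog M archPk archSub Ψ act Mmod region n lat sig split qData thetaBox qCentre hq hfin).frame
        j vQ =
      (settingDHVol X hlog M archPk archSub Ψ act Mmod region n lat sig split qData thetaBox qCentre hq hfin).frame
        j vQ :=
  rfl

/-- Same possible images of the Θ-pilot object (same Θ-boxes, same comparison, same (Ind1)(Ind2)-group of the
common log-shell signature). [folklore] -/
theorem possibleImages_settingDHFrames (j : (thetaIndex X).Label) (vQ : (thetaIndex X).VQ) :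
    (settingDHFrames X hlog M archPk archSub Ψ act Mmod region n lat sig split qData thetaBox qCentre hq
        hfin).possibleImages j vQ =
      (settingDHVol X hlog M archPk archSub Ψ act Mmod region n lat sig split qData thetaBox qCentre hq
        hfin).possibleImages j vQ :=
  rfl

/-- Same `q`-pilot region. [folklore] -/
theorem qRegion_settingDHFrames (j : (thetaIndex X).Label) (vQ : (thetaIndex X).VQ) :
    (settingDHFrames X hlog M archPk archSub Ψ act Mmod region n lat sig split qData thetaBox qCentre hq
        hfin).qRegion j vQ =
      (settingDHVol X hlog M archPk archSub Ψ act Mmod region n lat sig split qData thetaBox qCentre hq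
        hfin).qRegion j vQ :=
  rfl

/-- Same hull `^{n,∘}𝒰_{j,v_ℚ}` of the union of the possible images. [folklore] -/
theorem thetaHull_settingDHFrames (j : (thetaIndex X).Label) (vQ : (thetaIndex X).VQ) :
    (settingDHFrames X hlog M archPk archSub Ψ act Mmod region n lat sig split qData thetaBox qCentre hq
        hfin).thetaHull j vQ =
      (settingDHVol X hlog M archPk archSub Ψ act Mmod region n lat sig split qData thetaBox qCentre hq
        hfin).thetaHull j vQ :=
  rfl

/-- Same `HullDefined` ("admits its holomorphic hull" is read on the same frame). [folklore] -/
theorem hullDefined_settingDHFrames_iff (j : (thetaIndex X).Label) (vQ : (thetaIndex X).VQ) :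
    (settingDHFrames X hlog M archPk archSub Ψ act Mmod region n lat sig split qData thetaBox qCentre hq
        hfin).HullDefined j vQ ↔
      (settingDHVol X hlog M archPk archSub Ψ act Mmod region n lat sig split qData thetaBox qCentre hq
        hfin).HullDefined j vQ :=
  Iff.rfl

/-- **Same local `q`-volume**: `qLocal j v_ℚ` read in the field-box container equals `qLocal j v_ℚ` read in the
verbatim summandwise container (§3 at the hull-set `λ_q·𝒪_L`, `λ_q ≠ 0`). [claim: Mochizuki2012, status: disputed] -/
theorem qLocal_settingDHFrames (j : (thetaIndex X).Label) (vQ : (thetaIndex X).VQ) :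
    (settingDHFrames X hlog M archPk archSub Ψ act Mmod region n lat sig split qData thetaBox qCentre hq
        hfin).qLocal j vQ =
      (settingDHVol X hlog M archPk archSub Ψ act Mmod region n lat sig split qData thetaBox qCentre hq
        hfin).qLocal j vQ := by
  show (frameVolumePiecesDH X hlog).logvol j vQ
      (factorMapDH X hlog j vQ ⁻¹' hullSet (factorFieldDH X hlog j vQ) (qCentre (qPilotObject qData) j vQ)) =
    ((situationDHVol X hlog M archPk archSub Ψ act Mmod region).D n).logvol j vQ
      (factorMapDH X hlog j vQ ⁻¹' hullSet (factorFieldDH X hlog j vQ) (qCentre (qPilotObject qData) j vQ))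
  exact logvol_frameVolumePiecesDH_preimage_hullSet X hlog M archPk archSub Ψ act Mmod region n j vQ _ (hq j vQ)

/-- **Same local `−|log(Θ)|`**: when the union of the possible images admits its hull, that hull is the preimage of a
hull-set `λ·𝒪_L` of the common frame, on which the two containers agree (§3); otherwise both read `+∞`.
[claim: Mochizuki2012, status: disputed] -/
theorem thetaLocal_settingDHFrames (j : (thetaIndex X).Label) (vQ : (thetaIndex X).VQ) :
    (settingDHFrames X hlog M archPk archSub Ψ act Mmod region n lat sig split qData thetaBox qCentre hq
        hfin).thetaLocal j vQ =
      (settingDHVol X hlog M archPk archSub Ψ act Mmod region n lat sig split qData thetaBox qCentre hq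
        hfin).thetaLocal j vQ := by
  set P₂ := settingDHVol X hlog M archPk archSub Ψ act Mmod region n lat sig split qData thetaBox qCentre hq hfin
    with hP₂
  unfold Cor312.Setting.thetaLocal
  by_cases h : P₂.HullDefined j vQ
  · rw [if_pos (show (settingDHFrames X hlog M archPk archSub Ψ act Mmod region n lat sig split qData thetaBox
        qCentre hq hfin).HullDefined j vQ from h), if_pos h]
    congr 1
    obtain ⟨H', hH', hEq⟩ := (P₂.frame j vQ).hull_mem_of_hasHull h.1 h.2
    show (frameVolumePiecesDH X hlog).logvol j vQ (P₂.thetaHull j vQ) =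
      ((situationDHVol X hlog M archPk archSub Ψ act Mmod region).D n).logvol j vQ (P₂.thetaHull j vQ)
    rw [show P₂.thetaHull j vQ = factorMapDH X hlog j vQ ⁻¹' H' from hEq]
    exact logvol_frameVolumePiecesDH_preimage_of_isHullSet X hlog M archPk archSub Ψ act Mmod region n j vQ hH'
  · rw [if_neg (show ¬ (settingDHFrames X hlog M archPk archSub Ψ act Mmod region n lat sig split qData thetaBox
        qCentre hq hfin).HullDefined j vQ from h), if_neg h]

/-- **Same `ThetaFinite`** ("`−|log(Θ)| ∈ ℝ`", the first conjunct of the printed statement). [claim: Mochizuki2012, status: disputed] -/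
theorem thetaFinite_settingDHFrames_iff :
    (settingDHFrames X hlog M archPk archSub Ψ act Mmod region n lat sig split qData thetaBox qCentre hq
        hfin).ThetaFinite ↔
      (settingDHVol X hlog M archPk archSub Ψ act Mmod region n lat sig split qData thetaBox qCentre hq
        hfin).ThetaFinite := by
  simp only [Cor312.Setting.ThetaFinite, thetaLocal_settingDHFrames]

/-- **Same `−|log(Θ)|`.** [claim: Mochizuki2012, status: disputed] -/
theorem negLogTheta_settingDHFrames :
    (settingDHFrames X hlog M archPk archSub Ψ act Mmod region n lat sig split qData thetaBox qCentre hq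
        hfin).negLogTheta =
      (settingDHVol X hlog M archPk archSub Ψ act Mmod region n lat sig split qData thetaBox qCentre hq
        hfin).negLogTheta := by
  unfold Cor312.Setting.negLogTheta
  by_cases h : (settingDHVol X hlog M archPk archSub Ψ act Mmod region n lat sig split qData thetaBox qCentre hq
      hfin).ThetaFinite
  · rw [if_pos ((thetaFinite_settingDHFrames_iff X hlog M archPk archSub Ψ act Mmod region n lat sig split qData
      thetaBox qCentre hq hfin).mpr h), if_pos h]
    simp only [thetaLocal_settingDHFrames]
  · rw [if_neg (mt (thetaFinite_settingDHFrames_iff X hlog M archPk archSub Ψ act Mmod region n lat sig split qData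
      thetaBox qCentre hq hfin).mp h), if_neg h]

/-- **Same `−|log(q)|`.** [claim: Mochizuki2012, status: disputed] -/
theorem negLogQ_settingDHFrames :
    (settingDHFrames X hlog M archPk archSub Ψ act Mmod region n lat sig split qData thetaBox qCentre hq
        hfin).negLogQ =
      (settingDHVol X hlog M archPk archSub Ψ act Mmod region n lat sig split qData thetaBox qCentre hq
        hfin).negLogQ := by
  unfold Cor312.Setting.negLogQ
  simp only [qLocal_settingDHFrames]

/-- **CONTAINER-ROBUSTNESS OF THE TYPED COROLLARY 3.12 AT THE ASSEMBLED REAL SETTING.** The printed statement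
"`−|log(Θ)| ∈ ℝ` and `−|log(Θ)| ≥ −|log(q)|`" ([IUTchIII] Cor. 3.12, kurims p. 174 l. 16–18), typed by c312-7 as
`Cor312.Setting.Statement`, holds for the real log-shells of `F` with `𝕄(−)` read as BOXES OVER THE FIELD FACTORS
(`Real.settingDHFrames`: c312-6/c312-7 frames route) iff it holds with `𝕄(−)` read VERBATIM as direct products over the
SUMMANDS `v⃗` (`Real.settingDHVol`: c312-5 route) — same Θ-boxes, `q`-centre and context data. Neither side is
asserted. [claim: Mochizuki2012, status: disputed] -/
theorem statement_settingDHFrames_iff :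
    (settingDHFrames X hlog M archPk archSub Ψ act Mmod region n lat sig split qData thetaBox qCentre hq
        hfin).Statement ↔
      (settingDHVol X hlog M archPk archSub Ψ act Mmod region n lat sig split qData thetaBox qCentre hq
        hfin).Statement := by
  unfold Cor312.Setting.Statement
  rw [negLogTheta_settingDHFrames, negLogQ_settingDHFrames]

end Real

end Thm311

end IUTFork

end Summit.ABC

end
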